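import Mathlib
import Literature.Computability.AlgebraicComplexity.AsymptoticRankLimit
import Literature.Computability.AlgebraicComplexity.AsymptoticRankBorderRank

/-!
# `R̃(t^{⊠N}) = R̃(t)^N` and `R̃(t) ≤ bR(t^{⊠N})^{1/N}`

Solo-informed seat, door D6 (group realizations of Kronecker powers of `T_{cw,2}`), support file.
The tree has `R̃(t^{⊠k}) ≤ R̃(t)^k` (`asymptoticRank_kroneckerPow_le`) and Fekete's limit
`R(t^{⊠n})^{1/n} → R̃(t)` (`advxxz2025_asymptoticRank_tendsto`); here we record the equality
`R̃(t^{⊠N}) = R̃(t)^N` (the subsequence `n = MN` of the Fekete limit) and the consequence used by the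
door: a border-rank bound on ONE Kronecker power bounds the asymptotic rank of the base tensor,
`bR(t^{⊠N}) ≤ r ⇒ R̃(t) ≤ r^{1/N}`.

References: Christandl–Vrana–Zuiddam, *Universal points in the asymptotic spectrum of tensors*,
JAMS 2023, §1.1 (`R̃` is the limit = infimum); Bürgisser–Clausen–Shokrollahi 1997, Lemma (15.27)
(`R̃ ≤ bR`).
-/

noncomputable section

open scoped BigOperators
open Filter Topology

namespace Summit.MatrixMultiplication.MatrixMultiplication.Theorems

open Literature.Computability.AlgebraicComplexity

variable {K : Type*} [Field K] {ι κ μ : Type*} [Fintype ι] [Fintype κ] [Fintype μ]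

/-- **`R̃(t^{⊠N}) = R̃(t)^N`** for `N ≥ 1`: both sides are the limit of `R(t^{⊠MN})^{1/M}` as
`M → ∞` (Fekete's limit for `t^{⊠N}`, resp. the `N`-th power of the subsequence `n = MN` of Fekete's
limit for `t`). [cite: ChristandlVranaZuiddam2023, §1.1] -/
theorem asymptoticRank_kroneckerPow_eq (t : ι → κ → μ → K) {N : ℕ} (hN : 0 < N) :
    asymptoticRank (kroneckerPow t N) = asymptoticRank t ^ N := by
  have hg := advxxz2025_asymptoticRank_tendsto (kroneckerPow t N)
  set f : ℕ → ℝ := fun n => (tensorRank (kroneckerPow t n) : ℝ) ^ ((n : ℝ)⁻¹) with hfdef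
  have hf : Tendsto f atTop (𝓝 (asymptoticRank t)) := advxxz2025_asymptoticRank_tendsto t
  have hsub : Tendsto (fun M : ℕ => M * N) atTop atTop :=
    tendsto_atTop_atTop.2 fun b => ⟨b, fun M hM => hM.trans (Nat.le_mul_of_pos_right M hN)⟩
  have hfN : Tendsto (fun M : ℕ => f (M * N) ^ N) atTop (𝓝 (asymptoticRank t ^ N)) :=
    (hf.comp hsub).pow N
  have heq : ∀ᶠ M : ℕ in atTop,
      (tensorRank (kroneckerPow (kroneckerPow t N) M) : ℝ) ^ ((M : ℝ)⁻¹) = f (M * N) ^ N := by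
    filter_upwards [eventually_gt_atTop 0] with M hM
    rw [hfdef, ← Literature.Barriers.MatrixMultiplication.tensorRank_kroneckerPow_mul t M N,
      ← Real.rpow_natCast,
      ← Real.rpow_mul (Nat.cast_nonneg _)]
    congr 1
    have hM0 : (M : ℝ) ≠ 0 := by exact_mod_cast hM.ne'
    have hN0 : (N : ℝ) ≠ 0 := by exact_mod_cast hN.ne'
    push_cast
    field_simp
  exact tendsto_nhds_unique (hg.congr' heq) hfN

/-- **One power bounds the asymptotic rank**: `bR(t^{⊠N}) ≤ r` with `N ≥ 1` gives
`R̃(t) ≤ r^{1/N}` (`R̃(t)^N = R̃(t^{⊠N}) ≤ bR(t^{⊠N})`). [cite: BurgisserClausenShokrollahi1997, Lemma (15.27)] -/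
theorem asymptoticRank_le_rpow_of_algBorderRank_kroneckerPow_le [DecidableEq ι] [DecidableEq κ]
    [DecidableEq μ] {t : ι → κ → μ → K} {N r : ℕ} (hN : 0 < N)
    (h : algBorderRank (kroneckerPow t N) ≤ r) :
    asymptoticRank t ≤ (r : ℝ) ^ ((N : ℝ)⁻¹) := by
  have h0 := asymptoticRank_nonneg t
  have h1 : asymptoticRank t ^ N ≤ r := by
    rw [← asymptoticRank_kroneckerPow_eq t hN]
    exact asymptoticRank_le_of_algBorderRank_le h
  calc asymptoticRank t = (asymptoticRank t ^ N) ^ ((N : ℝ)⁻¹) :=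
        (Real.pow_rpow_inv_natCast h0 hN.ne').symm
    _ ≤ (r : ℝ) ^ ((N : ℝ)⁻¹) := Real.rpow_le_rpow (pow_nonneg h0 N) h1 (by positivity)

end Summit.MatrixMultiplication.MatrixMultiplication.Theorems

end
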